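import Summits.NavierStokesRegularity.NavierStokesRegularity.Theorems.PalasekTowerBreakdownEpisodeBaseTMechanismFreeRun
import Literature.Analysis.FluidPDE.AxisymmetricEuler
import Literature.Analysis.FluidPDE.Hou2022InitialData
import Literature.Analysis.FluidPDE.HouInteriorCollapseRuns

/-!
# Line `hou_late_snapshot` for the crux `PalasekTowerBreakdown.EpisodeBaseT` (stmt-20303) — START ON THE UNSTABLE MANIFOLD:
# the episode datum is Hou's `t₀`-SNAPSHOT («the new initial condition», arXiv:2107.06509 p8) of the tornado run, re-compactified
# and Reynolds-cut ×10, so that the tuned window `[1, τ₁]` IS his viscous-robust late phase (`ν = 5·10⁻³`, growth laws R² ≈ 1)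

Seat ns-idea-12 g3 (D-0145 ideator, lens «oqh»). FILES ONLY (KEY-NS #87/#93): nothing registered; no summit, no crux and no
Navier–Stokes statement is proved by this file. `sorry` occurs exactly in the three `stub_*` theorems.

## Why this line (what LINE g3-1 `hou_tornado` taught: the REYNOLDS SQUEEZE is about the FUSE, so skip the fuse)
`Lines/hou_tornado.lean` transplants Hou's INITIAL datum; its fuse (3.2 turnovers from rest) must fill the window `w₀ = 170/A₀`, which
forces `Re_ℓ ≈ 10⁴`, fifteen times short of the regime where Hou saw the transition (`ν = 5·10⁻⁴`; «if the viscosity is too large, it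
would destroy the mechanism», p7 L6) — predicted NO-ONSET at tuned. But Hou's computation has TWO phases (p7 L6–8, p8 L8, p11 L16–19):
`ν = 5·10⁻⁴` on `[0, t₀]`, `t₀ = 2.27375·10⁻³`, by which `‖ω‖_∞` has grown only `×498`; then «we can also regard the solution at t₀ as
the new initial condition for the subsequent computation using the larger viscosity ν = 5·10⁻³» (p8 L8), and in THAT phase, at the
TEN TIMES LARGER viscosity, `‖ω‖_∞` grows from `×515` to `×10⁷` with `‖u‖_∞ ∼ (T−t)^{−1/2}`, `‖u₁‖_∞, ‖ψ_{1z}‖_∞ ∼ (T−t)^{−1}`,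
`Z ∼ (T−t)^{1/2}` fitted with R² ≈ 1 (p11 L16–50), vortex stretching ≥ 5 × diffusion throughout (p16 §3.7), the rescaled profile
stable to 1 % perturbations of the data (p15–16 §3.6, Cases 1–3), while the SMALL viscosity kept for all time (Case 4) gives a
two-scale wave with «viscous dominance in the late stage» and growth only `×2078` (p16 L11). So the late phase is the VISCOUS-ROBUST
regime, and by Navier–Stokes scaling every scale-free number of it is fixed: this line takes the `t₀`-snapshot itself as the episode
datum. The tuned register's small Reynolds number stops being an obstruction: it only sets the datum AMPLITUDE `s·Y₀` through ONE
printed invariant (below). Lever (oqh): an open question the author states on the page — is the `t₀` field a bona fide initial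
condition for singular(-looking) growth at `ν = 5·10⁻³`? — read through the K1G door.

## The member (§1–§2) in units length 1/N₀, speed N₀, time 1/N₀² (ν = 1)
EARLY RUN (pre-processing, not part of the episode): `W₀ := curl (potH pEarly)`, the ℝ³ transplant of Hou's datum at HIS early
viscosity: by `v ↦ ν⁻¹v(·, t/ν)` (NS_ν → NS₁) with Hou's length unit as ours, `pEarly = (S, Λ, σ_z, ρ₀) = (12000/ν_e, 1, 3/2, 32/5)
= (2.4·10⁷, 1, 3/2, 32/5)` and Hou's `t₀` is our `tE = ν_e t₀ = 1.136875·10⁻⁶`. SNAPSHOT `V := v(tE)`. EPISODE DATUM (t = 1):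
`W := curl (lateP V κ ρ)`, `lateP V κ ρ x = cutoff_ρ(x) · (1/10) · NewtonPot(curl V)(κx)` — i.e. `W ≈ (κ/10)·V(κx)` inside the
cut-off: the snapshot's SHAPE, rescaled by `κ`, with amplitude `κ/10` instead of the NS-symmetric `κ` = Reynolds number cut by
`ν_e/ν_l = 1/10` (Hou's viscosity switch expressed at fixed ν). Our run from `W` on `[1, τ₁]` is then, inside the cut-off and up to the
transplant differences T1–T3 below, EXACTLY Hou's late computation: `w(x, 1 + t) = (λ/ν_l) v_H(λx, t₀ + λ²t/ν_l)`, `λ = κ`·(Hou length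
per early length = 1).
DIALS AND THE THREE PRINTED INVARIANTS. Let `Π := (T − t)‖u(t)‖²_∞/ν_l` (constant along the fitted late phase, = 1/(ν_l × slope of
the linear fit of `‖u‖_∞^{−2}` against `t`, Fig. «linear_regression_vel_nse» (a), p11 L41–45)), `G := R(t)²‖u₁(t)‖_∞ = Γ̃` at the
maximum location (constant along the phase; trajectory Fig. p7 §3.2 + growth Fig. p8), `D := log₁₀((T − t_s)/(T − t₄))` = decades of
`(T−t)` actually computed in the late phase (`‖ω‖ ×515 → ×10⁷` with `‖ω‖ ∼ |log|/(T−t)` ⇒ `D ≈ 4`). Then, with target speed `u_f = 2.8 Y₀`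
at `τ₁`: datum amplitude `s = ‖W‖_∞/Y₀` solves `s² Y₀² w₀ /(1 − (s/2.8)²) = Π`, i.e. `s ≈ (Π/1.32·10⁵)^{1/2}` (`Y₀²w₀ = Re₀·(A₀w₀) =
776·170 = 1.32·10⁵`); `κ = 10 s Y₀/‖V‖_∞`; decades to ride `log₁₀(7.84·1.32·10⁵/Π) = log₁₀(1.03·10⁶/Π)`; faces at `τ₁`: speed `2.8 Y₀` by
the dial (law MEASURED, not a placeholder; cap automatic: monotone); gradient `≈ ‖u‖²/(νΓ̃-scale) = (2.8Y₀)²/Re_core ≈ 6·10³ A₀/Re_core`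
precisely `‖∇u‖(τ₁) = κ_g (2.8Y₀)² = 6.1·10³ κ_g A₀` with the invariant `κ_g := ν_l‖∇u‖_∞/‖u‖²_∞ ≈ (‖ω‖_∞/‖u₁‖_∞)/(200 G)`, so the
gradient face holds iff `G ≤ 8.8·‖ω‖_∞/‖u₁‖_∞` (`≥ 17.6`: large slack); LOOP (the critical face here): an axis-centred 4-wound circle of
radius `1/N₁` sits at Hou radius `r_H ≈ (6.5/G)·R(τ₁) ≫ R(τ₁)` (outside the collapsed core) and carries `8π Γ̃`, `Γ̃_ours = Γ̃_H/ν_l =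
200 Γ̃_H`; it needs `Γ̃_ours ≥ 955/8π = 38`, i.e. `Γ̃_H ≥ 0.19`: alive iff `G ≥ 0.19` (one winding: `0.76`; ceiling `‖Γ̃‖_∞ = 64.8` by the
maximum principle; `G ≈ ‖u‖²_∞/‖u₁‖_∞` is read off the two growth plots of p8 at any common late time). WINDOWS: `Π ≤ 1.5·10⁵` (`s < 1`,
anchor) and `log₁₀(1.03·10⁶/Π) ≤ D ≈ 4` (`Π ≳ 10²`); `0.19 ≤ G ≤ 8.8‖ω‖_∞/‖u₁‖_∞`. Desk reading of §3.7 (stretching/diffusion ≈ 5 at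
`(R, Z)`) puts the late core at circulation Reynolds number `Γ̃/ν_l = O(10–10²)`, i.e. `G = O(0.05–0.5)`: the loop face is MARGINAL and
is what S0 reads first. TEXT-NUMBER ESTIMATES (no figure needed; p7 L16, p11 L16, p12 L1): `‖ω‖` grows ×10⁴, 10⁵, 10⁶, 10⁷ at `t₁ … t₄` with
`ω ∼ 1/(T−t)` ⇒ `T − t₄ ≈ (t₄ − t₃)/9 ≈ 5·10⁻¹⁰`, `D = log₁₀((T−t_s)/(T−t₄)) ≈ 4.3`; `p_min(t₄) ≈ −10¹⁰ ≈ −c‖u‖²` ⇒ `‖u(t₄)‖_∞ ≈ 10⁵` ⇒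
`Π ≈ 5·10⁻¹⁰·10¹⁰/5·10⁻³ ≈ 1–2·10³` (window ✓; `s ≈ 0.11`, 2.8 decades to ride ≤ 4.3 ✓, episode datum Reynolds number ≈ 30–100); `κ_g = ν‖ω‖/‖u‖² ≈
5·10⁻³·7.5·10¹⁰/10¹⁰ ≈ 0.03` ⇒ gradient at `τ₁ ≈ 2·10² A₀ ≫ 3.48 A₀` ✓; `G ≈ R(t₄)‖u(t₄)‖ ≈ (2–3)·(‖u‖/‖ω‖)·‖u‖ ≈ 0.3` (×/÷3) against the
need `0.19`: MARGINAL — S0(ii) is the decider.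

## Stubs (typed in §2) and the decider
E `EarlyRunE` (XL as a certificate; numerically = Hou's early phase, the expensive one) · S `SnapshotStaticE` (L: smoothness of the
cut-off Newtonian potential of the snapshot's vorticity — parabolic smoothing + Gaussian vorticity tails; support clause PROVED) ·
M `LateMemberE` (LOAD-BEARING: for the snapshot there are dials `κ, ρ > 0` with the anchor, a classical late run on `[1, τ₁]`, and the
four faces for every such run). DECIDER S0″ (ZERO compute — FOUR figure reads in arXiv:2107.06509 / FoCM version of record, acq-14088;
PRE-REGISTERED words `Lines/hou_late_snapshot_prereg.md` v2, answering idea-crit-7 g3 P1–P3): (i) `Π` at the datum time `t₀` (and `Π_law =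
1/(ν_l a)` from the `‖u‖⁻²` fit); (ii) `G = R²‖u₁‖_∞` at TWO late times (constancy = a check of the laws; loop premise: `Γ̃ = r u^θ`
non-decreasing from the core radius `R` out to `r_H ≈ (6.5/G)R` — Rayleigh-stable core — or `Γ̃(r_H)` read directly from a `Γ` plot);
(iii) the RESOLVED decade count `D_res = log₁₀((T−t₀)/(T−t₃))`, `t₃ = 0.0022868453` (×10⁶, «still well resolved»), binding — `D_fit` to `t₄`
printed only; (iv) the `u₁`-stretching/diffusion ratio at the end of the needed stretch ≥ 2. Words: `Π ≤ 1.5·10⁵` ∧ `log₁₀(1.03·10⁶/Π + 1) ≤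
D_res` ∧ `0.19 ≤ G ≤ 8.8‖ω‖_∞/‖u₁‖_∞` ∧ ratio ≥ 2 ⇒ ALIVE-ON-PAPER, else DEAD-ANCHOR / DEAD-DECADES / DEAD-LOOP / DEAD-GRADIENT /
DEAD-SATURATION-ON-PAPER (say which). S1 (only after S0″; ≈ Hou's cost, 10²–10³ core-h, any
axisymmetric (u₁, ω₁, ψ₁) solver): his protocol to `t₀` in the ℝ³ transplant (`potH pEarly`, no wall), then the Reynolds-cut rescaled
snapshot at ν-equivalent `5·10⁻³` for `1.03·10⁶/Π` in `(T−t)`: read the four faces. Instrument row refuting M: S0 fails a window; or S1's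
late run saturates (stretching/diffusion → 1) before `‖u‖_∞` has grown by `2.8/s`.

## Why it might fail (numbered)
R1 LOOP: `G < 0.19` (viscous core carries too little circulation) — S0(ii). R2 DECADES: `Π < 10²` forces more than the `≈ 4` computed
decades — S0(i,iii) (text estimate: passes). R3 Hou's late phase is partly numerical (mesh-change dissipation drives a wave toward `z = 0`,
p16 bottom; «qualitative» fits, p12 Remark), and the later arXiv version is retitled «The nearly singular behavior of the 3D Navier–Stokes
equations» (local citation graph header for arXiv:2107.06509): the author's revised reading is enormous-but-saturating growth — this member
needs only a FINITE stretch of the computed phase (speed ×2.8/s ≈ ×25, i.e. 2.8 decades of `(T−t)` out of ≈ 4.3), but S0/S1 must be read on the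
version of record (FoCM, doi:10.1007/s10208-022-09578-4) — S1. T1 no wall / Gaussian axial envelope in the EARLY phase (99.4 % of Hou's fuse, where the far field does evolve;
the inward flow along `z = 0` that feeds the core is driven by the swirl modulation, not by the wall at `r = 1` where `u₁ ∝ (1−r²)^18` is
negligible — moderate). T2 re-compactification error at `t = 1` (cut-off far outside the core; §3.6 stability to 1 % data perturbations).
T3 certificate: E and M as kernel objects are W12-infeasible (as every free-run member); DESIGN line, bears_on N1, MODEL/NS-design class.
CENSUS WORDING (BC4): the DATUM and the viscosity SCHEDULE are known-in-tree — `Hou2022.initialU1`, `Hou2022.initialVelocity`, `Hou2022.nuEarly`,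
`Hou2022.nuLate`, `Hou2022.tSwitch`, `Hou2022.nuLate_eq_ten_mul_nuEarly` (`Literature/Analysis/FluidPDE/Hou2022InitialData.lean`), used here
BY NAME (`pEarly.S`, `tE`, `reCut`, `gH_eq_initialU1_axis`); the fitted late laws are data in `HouTwoScaleRescaling.lean`'s docstrings. The line's
own content is the ℝ³ transplant of the early run, the SNAPSHOT-AS-DATUM move with the Reynolds cut, the invariants `Π, G, D` with their windows,
and the K1G-door reading `episodeBaseT_of`.
-/

noncomputable section

set_option linter.dupNamespace false

namespace Summit.NavierStokesRegularity.NavierStokesRegularity.Cruxes.EpisodeBaseT.HouLateSnapshot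

open Set MeasureTheory Filter Topology Function Metric
open scoped ENNReal ContDiff NNReal
open Literature.Analysis.FluidPDE
open Summit.NavierStokesRegularity.FluidComputer
open Summit.NavierStokesRegularity.FluidComputer.PalasekTowerClayBridge
open Summit.NavierStokesRegularity.NavierStokesRegularity.Theses

/-! ## §0 Tuned numbers (abbreviations only) -/

/-- Base frequency `N₀(tuned) = 2^24`. -/
abbrev N0 : ℝ := TowerRates.tuned.N 0

/-- Datum speed bound `Y₀(tuned) = N₀^{7/5}`. -/
abbrev Y0 : ℝ := TowerRates.tuned.Y 0

/-- Base rate `A₀(tuned) = N₀^{12/5}`. -/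
abbrev A0 : ℝ := TowerRates.tuned.A 0

/-- End of the first window `τ₁ = 1 + w₀`. -/
abbrev τ1 : ℝ := Host.τfirstAt TowerRates.tuned

/-! ## §1 The explicit datum class: cut-off potential of Hou's modulated swirl — time `t = 1` only -/

/-- Static data of the transplanted Hou datum: swirl-rate amplitude `S` (Hou's `12000`), length unit `Λ` (Hou's cylinder radius
and axial period), axial envelope width `σz`, cut-off radius `ρ₀`. Nothing is prescribed after `t = 1`. -/
structure HouDatum where
  S : ℝ
  Λ : ℝ
  σz : ℝ
  ρ₀ : ℝ

/-- Squared distance to the symmetry (`x₂`-)axis, `ϖ² = y₀² + y₁²`. -/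
def cylSq (y : EuclideanSpace ℝ (Fin 3)) : ℝ := y 0 ^ 2 + y 1 ^ 2

/-- The axial unit vector `e₃`. -/
def e3 : EuclideanSpace ℝ (Fin 3) := EuclideanSpace.single 2 (1 : ℝ)

/-- Hou's axial profile `g(ζ) = sin(2πζ/Λ) / (1 + (25/2) sin²(πζ/Λ))` (odd, period `Λ`, biased toward `ζ = 0`; p6 L35–44). -/
def gH (p : HouDatum) (ζ : ℝ) : ℝ :=
  Real.sin (2 * Real.pi * ζ / p.Λ) / (1 + 25 / 2 * Real.sin (Real.pi * ζ / p.Λ) ^ 2)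

/-- The scalar potential `G(q, ζ) = (SΛ²/36) e^{−18q/Λ²} g(ζ) e^{−ζ²/(2σz²)}`; `−2 ∂_q G = S e^{−18q/Λ²} g(ζ) e^{−ζ²/(2σz²)}` is the
swirl rate `u₁ = u_θ/ϖ` of the datum. -/
def GH (p : HouDatum) (q ζ : ℝ) : ℝ :=
  p.S * p.Λ ^ 2 / 36 * Real.exp (-18 * q / p.Λ ^ 2) * gH p ζ * Real.exp (-ζ ^ 2 / (2 * p.σz ^ 2))

/-- Radial smooth cut-off: `= 1` for `‖x‖ ≤ ρ₀/√2`, `= 0` for `‖x‖ ≥ ρ₀`. -/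
def cutoff (p : HouDatum) (x : EuclideanSpace ℝ (Fin 3)) : ℝ :=
  Real.smoothTransition (2 - 2 * ‖x‖ ^ 2 / p.ρ₀ ^ 2)

/-- THE EXPLICIT COMPACTLY SUPPORTED POTENTIAL: `cutoff · G(ϖ², x₂) · e₃`; its curl is the pure-swirl datum. -/
def potH (p : HouDatum) (x : EuclideanSpace ℝ (Fin 3)) : EuclideanSpace ℝ (Fin 3) :=
  (cutoff p x * GH p (cylSq x) (x 2)) • e3

/-- THE REGIME: positive scales, nondegenerate amplitude, cut-off far outside the envelope (`6Λ ≤ ρ₀`, `σz ≤ 2Λ`). -/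
def RegimeH (p : HouDatum) : Prop :=
  0 < p.Λ ∧ 0 < p.σz ∧ 0 < p.ρ₀ ∧ p.S ≠ 0 ∧ 6 * p.Λ ≤ p.ρ₀ ∧ p.σz ≤ 2 * p.Λ

/-! ## §1b Proved static facts (no sorry) -/

theorem N0_pos : 0 < N0 := TowerRates.tuned.N_pos 0

theorem Y0_pos : 0 < Y0 := Real.rpow_pos_of_pos (TowerRates.tuned.N_pos 0) _

theorem A0_pos : 0 < A0 := TowerRates.tuned.A_pos 0

/-- The cut-off is smooth. -/
theorem cutoff_contDiff (p : HouDatum) : ContDiff ℝ ∞ (cutoff p) := by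
  have h : ContDiff ℝ ∞ (fun x : EuclideanSpace ℝ (Fin 3) => 2 - 2 * ‖x‖ ^ 2 / p.ρ₀ ^ 2) :=
    contDiff_const.sub ((contDiff_const.mul (contDiff_norm_sq ℝ)).div_const _)
  exact Real.smoothTransition.contDiff.comp h

/-- The cut-off vanishes outside the ball of radius `ρ₀` (for `ρ₀ > 0`). -/
theorem cutoff_eq_zero_of_le (p : HouDatum) (hρ : 0 < p.ρ₀) {x : EuclideanSpace ℝ (Fin 3)} (hx : p.ρ₀ ≤ ‖x‖) :
    cutoff p x = 0 := by
  unfold cutoff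
  apply Real.smoothTransition.zero_of_nonpos
  have hx2 : p.ρ₀ ^ 2 ≤ ‖x‖ ^ 2 := pow_le_pow_left₀ hρ.le hx 2
  have hρ2 : 0 < p.ρ₀ ^ 2 := by positivity
  rw [sub_nonpos, le_div_iff₀ hρ2]
  linarith

/-- **Support clause of stub A, proved:** `tsupport (potH p) ⊆ B̄(0, ρ₀)` whenever `ρ₀ > 0`. -/
theorem potH_tsupport_subset (p : HouDatum) (hρ : 0 < p.ρ₀) :
    tsupport (potH p) ⊆ closedBall (0 : EuclideanSpace ℝ (Fin 3)) p.ρ₀ := by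
  refine closure_minimal (fun x hx => ?_) isClosed_closedBall
  rw [mem_closedBall, dist_zero_right]
  by_contra h
  push Not at h
  apply hx
  show potH p x = 0
  simp only [potH, cutoff_eq_zero_of_le p hρ h.le, zero_mul, zero_smul]


/-! ## §1c The early datum, the snapshot time, the re-compactified Reynolds-cut late potential -/

/-- **By-name comparand (BC4):** the axial profile `g` IS Hou's printed `u₁(0, 0, ·)/12000` read at period `Λ`:
`gH p ζ = Hou2022.initialU1 0 (ζ/Λ) / 12000` (`Literature/Analysis/FluidPDE/Hou2022InitialData.lean`). The transplant replaces only the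
radial factor `(1 − r²)^18` of `Hou2022.initialU1` by `e^{−18r²}` (within 1 % at the swirl peak `r = 0.164`, 3 % for `r ≤ 0.24`, 7 % at `r = 0.3`) and adds the axial
Gaussian envelope and the cut-off (compact support in ℝ³ instead of the periodic no-slip cylinder). [cite: Hou2022PotentiallySingularNS, §2 eq. (2.2)] -/
theorem gH_eq_initialU1_axis (p : HouDatum) (ζ : ℝ) : gH p ζ = Hou2022.initialU1 0 (ζ / p.Λ) / 12000 := by
  have h1 : 2 * Real.pi * (ζ / p.Λ) = 2 * Real.pi * ζ / p.Λ := by ring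
  have h2 : Real.pi * (ζ / p.Λ) = Real.pi * ζ / p.Λ := by ring
  have hd : (1 + 25 / 2 * Real.sin (Real.pi * ζ / p.Λ) ^ 2) ≠ 0 := by positivity
  simp only [gH, Hou2022.initialU1, h1, h2]
  field_simp
  ring

/-- Hou's datum at his EARLY viscosity `Hou2022.nuEarly = 5·10⁻⁴` in our `ν = 1` clock with his length unit (`v ↦ ν_e⁻¹ v(·, t/ν_e)`):
amplitude `S = 12000/Hou2022.nuEarly = 2.4·10⁷` BY NAME, period `Λ = 1`, Gaussian axial envelope `σ_z = 3/2`, cut-off radius `32/5`.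
NOT the episode datum (no anchor needed): it only DEFINES the snapshot. [cite: Hou2022PotentiallySingularNS, §2 eq. (2.2), §3 p. 7] -/
def pEarly : HouDatum where
  S := 12000 / Hou2022.nuEarly
  Λ := 1
  σz := 3 / 2
  ρ₀ := 32 / 5

/-- Hou's switching time `Hou2022.tSwitch = t₀ = 2.27375·10⁻³` in our clock: `tE = Hou2022.nuEarly · Hou2022.tSwitch` BY NAME. -/
def tE : ℝ := Hou2022.nuEarly * Hou2022.tSwitch

/-- `tE = 1.136875·10⁻⁶`. -/
theorem tE_eq : tE = 1136875 / 10 ^ 12 := by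
  norm_num [tE, Hou2022.nuEarly, Hou2022.tSwitch]

theorem tE_pos : 0 < tE := by rw [tE_eq]; norm_num

/-- The Reynolds cut = Hou's viscosity switch at fixed `ν`: amplitude factor `Hou2022.nuEarly / Hou2022.nuLate` BY NAME. -/
def reCut : ℝ := Hou2022.nuEarly / Hou2022.nuLate

/-- `reCut = 1/10` (`Hou2022.nuLate_eq_ten_mul_nuEarly`). -/
theorem reCut_eq : reCut = 1 / 10 := by
  have h := Hou2022.nuLate_eq_ten_mul_nuEarly
  have hp := Hou2022.nuEarly_pos
  rw [reCut, h]
  field_simp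

/-- The early datum lies in the regime (`S = 2.4·10⁷ > 0`). -/
theorem regime_pEarly : RegimeH pEarly := by
  refine ⟨?_, ?_, ?_, ?_, ?_, ?_⟩ <;> norm_num [pEarly, Hou2022.nuEarly]

/-- Printed vorticity amplification of the EARLY phase, by the switching time `t₀`: «increased by a factor of 498.42» (p8 L4). -/
def earlyOmegaGain : ℝ := 49842 / 100

/-- The LATE-phase vorticity gain the member rides on = the total printed amplification
`HouCollapse.hou2022NS_vorticityAmplification = 10⁷` (BY NAME, `Literature/Analysis/FluidPDE/HouInteriorCollapseRuns.lean`; reached at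
`t₃* = t₄` to print precision, p12 L46) over the early gain: `≈ 2.0·10⁴ = (T − t₀)/(T − t₄)` under the printed law `‖ω‖_∞ ∼ (T−t)⁻¹`, i.e.
the source of the FITTED decade count `D_fit ≈ 4.3`. NOTE: `HouCollapse.hou2022NS_tResolved = 0.0022768453` is NOT cited here — it copies
the digit misprint of p7 L14 (the ×10⁶ «still well resolved» time is `t₃ = 0.0022868453`, p7 L16 / p8 L21; flagged by idea-crit-7 g3,
erratum for a literature seat); the RESOLVED decade count `D_res ≈ 3.4` of the pre-registration uses `t₃` from the text. -/
def lateOmegaGain : ℝ := HouCollapse.hou2022NS_vorticityAmplification / earlyOmegaGain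

/-- `lateOmegaGain = 10⁹/49842 (≈ 2.006·10⁴)`. -/
theorem lateOmegaGain_eq : lateOmegaGain = 10 ^ 9 / 49842 := by
  norm_num [lateOmegaGain, earlyOmegaGain, HouCollapse.hou2022NS_vorticityAmplification]

/-- The late gain exceeds four decades: `10⁴ < lateOmegaGain`. -/
theorem lateOmegaGain_gt : (10 : ℝ) ^ 4 < lateOmegaGain := by
  rw [lateOmegaGain_eq]; norm_num

/-- Radial smooth cut-off at radius `ρ`: `= 1` for `‖x‖ ≤ ρ/√2`, `= 0` for `‖x‖ ≥ ρ`. -/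
def cutoffR (ρ : ℝ) (x : EuclideanSpace ℝ (Fin 3)) : ℝ :=
  Real.smoothTransition (2 - 2 * ‖x‖ ^ 2 / ρ ^ 2)

/-- Newtonian vector potential `(1/4π) ∫ ζ(y)/‖x − y‖ dy` (for `ζ = curl V` with decay: a vector potential of `V`). -/
def newtonPot (ζ : EuclideanSpace ℝ (Fin 3) → EuclideanSpace ℝ (Fin 3)) (x : EuclideanSpace ℝ (Fin 3)) :
    EuclideanSpace ℝ (Fin 3) :=
  (1 / (4 * Real.pi)) • ∫ y, (‖x - y‖)⁻¹ • ζ y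

/-- THE LATE POTENTIAL of a snapshot `V` with dials `κ` (scale) and `ρ` (cut-off radius): `cutoff_ρ(x) · reCut · NewtonPot(curl V)(κx)`,
`reCut = Hou2022.nuEarly/Hou2022.nuLate = 1/10`. Its curl is `≈ (κ/10) V(κx)` inside the cut-off: the snapshot's shape at scale `1/κ` with
its Reynolds number cut by Hou's viscosity switch. -/
def lateP (V : EuclideanSpace ℝ (Fin 3) → EuclideanSpace ℝ (Fin 3)) (κ ρ : ℝ) (x : EuclideanSpace ℝ (Fin 3)) :
    EuclideanSpace ℝ (Fin 3) :=
  (cutoffR ρ x * reCut) • newtonPot (curl V) (κ • x)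

/-- The cut-off `cutoffR ρ` vanishes outside the ball of radius `ρ > 0`. -/
theorem cutoffR_eq_zero_of_le {ρ : ℝ} (hρ : 0 < ρ) {x : EuclideanSpace ℝ (Fin 3)} (hx : ρ ≤ ‖x‖) : cutoffR ρ x = 0 := by
  unfold cutoffR
  apply Real.smoothTransition.zero_of_nonpos
  have hx2 : ρ ^ 2 ≤ ‖x‖ ^ 2 := pow_le_pow_left₀ hρ.le hx 2
  have hρ2 : 0 < ρ ^ 2 := by positivity
  rw [sub_nonpos, le_div_iff₀ hρ2]
  linarith

/-- **Support clause of stub S, proved:** `tsupport (lateP V κ ρ) ⊆ B̄(0, ρ)` whenever `ρ > 0`, for every snapshot and scale. -/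
theorem lateP_tsupport_subset (V : EuclideanSpace ℝ (Fin 3) → EuclideanSpace ℝ (Fin 3)) (κ : ℝ) {ρ : ℝ} (hρ : 0 < ρ) :
    tsupport (lateP V κ ρ) ⊆ closedBall (0 : EuclideanSpace ℝ (Fin 3)) ρ := by
  refine closure_minimal (fun x hx => ?_) isClosed_closedBall
  rw [mem_closedBall, dist_zero_right]
  by_contra h
  push Not at h
  apply hx
  show lateP V κ ρ x = 0
  simp only [lateP, cutoffR_eq_zero_of_le hρ h.le, zero_mul, zero_smul]

/-! ## §2 The three stubs (typed), and the composition concluding the crux BY NAME -/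

/-- Classical finite-energy solutions of the EARLY run: `ν = 1`, zero force, on `[0, tE]`, from `curl (potH pEarly)`. -/
def IsEarlyRun (v : ℝ → EuclideanSpace ℝ (Fin 3) → EuclideanSpace ℝ (Fin 3)) (q : ℝ → EuclideanSpace ℝ (Fin 3) → ℝ) : Prop :=
  IsClassicalNSSolutionOn (Icc 0 tE) 1 0 v q ∧ v 0 = curl (potH pEarly) ∧
    (∃ C : ℝ≥0∞, C < ⊤ ∧ ∀ t ∈ Icc (0 : ℝ) tE, ∫⁻ x, ‖v t x‖ₑ ^ 2 ≤ C)

/-- Classical finite-energy solutions of the LATE run on the tuned window `[1, τ₁]` from the episode datum `curl (lateP V κ ρ)`. -/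
def IsLateRun (V : EuclideanSpace ℝ (Fin 3) → EuclideanSpace ℝ (Fin 3)) (κ ρ : ℝ)
    (v : ℝ → EuclideanSpace ℝ (Fin 3) → EuclideanSpace ℝ (Fin 3)) (q : ℝ → EuclideanSpace ℝ (Fin 3) → ℝ) : Prop :=
  IsClassicalNSSolutionOn (Icc 1 τ1) 1 0 v q ∧ v 1 = curl (lateP V κ ρ) ∧
    (∃ C : ℝ≥0∞, C < ⊤ ∧ ∀ t ∈ Icc (1 : ℝ) τ1, ∫⁻ x, ‖v t x‖ₑ ^ 2 ≤ C)

/-- The four tuned door faces (cap on `[1, τ₁]`; speed, gradient, 4-windable loop at `τ₁` inside `‖x‖ ≤ ρ`) for a run `v`. -/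
def FacesAt (ρ : ℝ) (v : ℝ → EuclideanSpace ℝ (Fin 3) → EuclideanSpace ℝ (Fin 3)) : Prop :=
  ∃ η : ℝ, 0 < η ∧
    (∀ t ∈ Icc (1 : ℝ) τ1, ∀ x, ‖v t x‖ ≤ 5 / 3 * TowerRates.tuned.Y 1 - η) ∧
    (∃ x, ‖x‖ ≤ ρ ∧ TowerRates.tuned.Y 1 + η ≤ ‖v τ1 x‖) ∧
    (∃ x, ‖x‖ ≤ ρ ∧ TowerRates.tuned.A 1 + η ≤ ‖fderiv ℝ (v τ1) x‖) ∧
    (∃ (x : EuclideanSpace ℝ (Fin 3)) (γ : ℝ → EuclideanSpace ℝ (Fin 3)),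
      ‖x‖ ≤ ρ ∧ ContDiff ℝ 1 γ ∧ γ 0 = γ 1 ∧
      (∀ s ∈ Icc (0 : ℝ) 1, γ s ∈ closedBall x (1 / TowerRates.tuned.N 1)) ∧
      (∀ s ∈ Icc (0 : ℝ) 1, ‖deriv γ s‖ ≤ 8 * Real.pi / TowerRates.tuned.N 1) ∧
      TowerRates.tuned.N 1 ^ (TowerRates.tuned.β - 2) + η ≤ circulation (v τ1) γ)

/-- **STUB E — THE EARLY RUN EXISTS CLASSICALLY (XL as a certificate; Hou's early phase `ν = 5·10⁻⁴` on `[0, t₀]` in ℝ³-transplant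
form; carries no stage, produces the snapshot).** Why it might fail: it does not (smooth compactly supported datum, `‖ω‖` grows only ×498
in Hou's run), but axisymmetric WITH swirl: no theorem. Its certificate also OWES the vorticity decay of `v tE` used by S and M (P4).
[cite: arXiv:2107.06509, §3.1 p7–8] -/
def EarlyRunE : Prop :=
  ∃ v q, IsEarlyRun v q

/-- **STUB S — SNAPSHOT STATIC LEMMA (analysis, L).** For every early run and all dials `κ, ρ > 0`, the late potential of the snapshot
`v tE` is `C^∞` (Newtonian potential of the smooth, Gaussian-tailed vorticity `curl (v tE)`: parabolic smoothing from `C^∞_c` data) —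
the support clause is `lateP_tsupport_subset`. Why it might fail: only through the regularity/decay the predicate `IsClassicalNSSolutionOn`
actually records for `v tE` (if too weak, add the parabolic-smoothing lemma as a support item). DECAY OWED (idea-crit-7 g3 P4): `IsEarlyRun`
records classical regularity + finite ENERGY only, not vorticity decay; `lateP` is built on the Bochner integral `newtonPot (curl V) (κx)`, so
the identification `curl (lateP V κ ρ) = reCut·κ·V(κ·)` inside the cut-off (a genuine vector potential: `div V = 0` ✓ plus `curl V ∈ L¹` with
decay) silently needs Gaussian vorticity tails of `v tE` from the compactly supported datum — true and standard, but part of what E/M's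
certificate OWES; a prover of S must not «prove» `ContDiff` of a junk-zero `lateP` (then M is false for the wrong reason: `W = 0` fails the
speed face, see M). -/
def SnapshotStaticE : Prop :=
  ∀ v q, IsEarlyRun v q → ∀ κ ρ : ℝ, 0 < κ → 0 < ρ → ContDiff ℝ ∞ (lateP (v tE) κ ρ)

/-- **STUB M — THE LATE MEMBER (LOAD-BEARING; decided on paper by S0 = three figure reads, numerically by S1).** For every early run there
are dials `κ, ρ > 0` such that the episode datum `W = curl (lateP (v tE) κ ρ)` obeys the anchor `‖W‖ < Y₀`, its `ν = 1` run on `[1, τ₁]`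
exists classically with finite energy, and EVERY such run shows the four tuned faces inside `‖x‖ ≤ ρ`. Informal content: Hou's late
phase (`ν_l = 5·10⁻³`, `‖u‖_∞ ∼ (T−t)^{−1/2}` over ≈ 4 decades) read at `κ = 10 s Y₀/‖V‖_∞`, `s = (Π/1.32·10⁵)^{1/2}`; alive iff
`Π ∈ [10², 1.5·10⁵]` and `G = R²‖u₁‖_∞ ≥ 0.19` (loop). Why it might fail: R1 loop (`G < 0.19`), R2 decades (binding count is the
RESOLVED one, `D_res = log₁₀((T−t₀)/(T−t₃)) ≈ 3.4`, slack ≈ 0.5 decade at `Π ≈ 1.5·10³` — MARGINAL), R3 numerical late phase / saturation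
(stretching/diffusion ratio must stay ≥ 2 to the end of the needed stretch — pre-registered read (iv)). DECAY OWED as in S: the same
Gaussian-tail certificate makes `newtonPot (curl (v tE))` a true vector potential; if it were Bochner-junk `0`, `W = 0` and the zero run
FAILS `FacesAt` — M is then false, never vacuously true. Pre-registered words: `Lines/hou_late_snapshot_prereg.md` (v2).
[cite: arXiv:2107.06509, §3.4 p11–12, §3.6–3.7 p15–16; HouCollapse.hou2022NS_vorticityAmplification] -/
def LateMemberE : Prop :=
  ∀ v q, IsEarlyRun v q → ∃ κ ρ : ℝ, 0 < κ ∧ 0 < ρ ∧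
    (∀ x, ‖curl (lateP (v tE) κ ρ) x‖ < Y0) ∧
    (∃ v' q', IsLateRun (v tE) κ ρ v' q') ∧
    (∀ v' q', IsLateRun (v tE) κ ρ v' q' → FacesAt ρ v')

/-- Stub E (early run). -/
theorem stub_earlyRunE : EarlyRunE := by
  sorry

/-- Stub S (snapshot static lemma). -/
theorem stub_snapshotStaticE : SnapshotStaticE := by
  sorry

/-- Stub M (late member: anchor, late run, faces). -/
theorem stub_lateMemberE : LateMemberE := by
  sorry

/-- **THE CRUX OF RECORD FROM THE THREE STUBS (sorry-free composition): early run ⊕ snapshot statics ⊕ late member ⟹ `EpisodeBaseT`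
BY NAME**, through the landed door `Theorems.palasekTowerBreakdown_episodeBaseT_of_mechanism_freeRun` at `W := curl (lateP (v tE) κ ρ)`;
static binders by `Germ.contDiff_curl_top`, `Germ.isDivFree_curl`, `Germ.tsupport_curl_subset` and the proved support clause.
[cite: Palasek2026ElementaryModel, §4] -/
theorem episodeBaseT_of (hE : EarlyRunE) (hS : SnapshotStaticE) (hM : LateMemberE) :
    PalasekTowerBreakdown.EpisodeBaseT := by
  obtain ⟨v, q, hv⟩ := hE
  obtain ⟨κ, ρ, hκ, hρ, hA, ⟨v', q', hrun⟩, hF⟩ := hM v q hv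
  have hsm : ContDiff ℝ ∞ (lateP (v tE) κ ρ) := hS v q hv κ ρ hκ hρ
  have hsupp := lateP_tsupport_subset (v tE) κ hρ
  obtain ⟨η, hη, hcap, hspeed, hstrain, hcore⟩ := hF v' q' hrun
  obtain ⟨hv', hv'1, hE'⟩ := hrun
  exact Theorems.palasekTowerBreakdown_episodeBaseT_of_mechanism_freeRun (Germ.contDiff_curl_top hsm)
    (Germ.isDivFree_curl hsm) (Germ.tsupport_curl_subset hsupp) hA hρ.le hv' hv'1 hE' hη hcap hspeed hstrain hcore

/-- The crux of record from the three stubs as registered names. -/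
theorem episodeBaseT_from_line : PalasekTowerBreakdown.EpisodeBaseT :=
  episodeBaseT_of stub_earlyRunE stub_snapshotStaticE stub_lateMemberE

end Summit.NavierStokesRegularity.NavierStokesRegularity.Cruxes.EpisodeBaseT.HouLateSnapshot

end
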